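import Literature.AlgebraicGeometry.GroupSchemes.GroupSchemeKernel
import Literature.AlgebraicGeometry.Morphisms.FlatOfRetract
import Mathlib.AlgebraicGeometry.Morphisms.Finite
import HarnessLib

/-!
# An idempotent endomorphism of a commutative group scheme splits it: `G ≅ Fix ε × Ker ε`; both factors are finite flat when `G` is

Topic `Literature/AlgebraicGeometry/GroupSchemes`; namespace `Literature.AlgebraicGeometry.GroupSchemes.IdempotentSplitting`.  Cell
`hodgecm-mathlib` (D-0151), FLOOR 0, P6 «MOD programme» generic organ (n4)(ii) = the interface-free conjunct of the P6b line's
`stub_L42_idempotentSplitting` (F0P6b-plan (g0) cand v2: «the idempotents `e_w ∈ 𝒪_F ⊗ ℤ∕p^n` split the finite flat commutative group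
scheme `X[p^n] = ∏_w X[w^n]`», σ2 «kernel of `1 − ε` + splitting `B.G n ≅ ker ε × ker(1−ε)`»); over ★ `GroupSchemes/GroupSchemeKernel`
(kernels as group objects) and ★ `Morphisms/FlatOfRetract` (a retract of a flat `S`-scheme is flat).  `--supports stmt-HodgeConjecture-24832`;
COUNT-NEUTRAL: HC_CM is proved only modulo the 7 printed citations until rung 0 closes; this file discharges none of them.
Seven `def`s (`fix`, `fixι`, `fixLift`, `fixRetract`, `kerRetract`, `fixGrpObj` (reducible), `splitIso`, `fixMap`) + theorems; no named fact,
no instance, no notation, no `sorry`.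

THE PRINT.  [GortzWedhorn2020] (4.15) Def. 4.45 (kernels of homomorphisms of group schemes as fibre products with the unit section;
subgroup schemes); the splitting of a commutative group (scheme) by an idempotent endomorphism `ε` — `G = εG × (1 − ε)G`, `εG = Fix ε =
Ker(1 − ε)` — is the standard bookkeeping behind `A[p^∞] = ∏_{w ∣ p} A[w^∞]` ([RapoportSmithlingZhang2020Diagonal] §4.1, [Tate1967] §2);
«a direct summand of a flat module is flat» ([AtiyahMacdonald1969] Ch. 2 Ex. 4) gives the flatness of the factors.  In Mathlib's
`Hom`-group notation (pointwise product in `G`) the endomorphism «`1 − ε`» is `𝟙 G ∕ ε : x ↦ x · ε(x)⁻¹`.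

WHAT IS HERE (for `G : Over S` with `[GrpObj G]`, `ε : G ⟶ G`):
* §1 (no commutativity, `ε` any endomorphism) **`fix ε := Ker(𝟙 ∕ ε)`** with `fixι` (mono, closed immersion for `G → S` separated),
  `fixι_comp : ι ≫ ε = ι`, the universal property `fixLift ∕ fixLift_ι ∕ fix_hom_ext`, and for IDEMPOTENT `ε` (`ε ≫ ε = ε`) the retraction
  **`fixRetract : G ⟶ Fix ε`** (`≫ ι = ε`, `ι ≫ fixRetract = 𝟙`), whence **`isFinite_fix_hom`, `flat_fix_hom`** (retract of a finite flat
  `S`-scheme);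
* §2 (`ε` an idempotent homomorphism) `one_div_comp_self : (𝟙 ∕ ε) ≫ ε = 1`, the retraction **`kerRetract : G ⟶ Ker ε`** (`≫ ι = 𝟙 ∕ ε`,
  `ι ≫ kerRetract = 𝟙`), **`isFinite_ker_hom`, `flat_ker_hom`**;
* §3 (commutative `G`, `ε` an idempotent homomorphism) `isMonHom_one_div`, the group structure **`fixGrpObj`** (a reducible `def`; ★
  `grpObjKer`), `isMonHom_fixι ∕ _fixLift ∕ _fixRetract ∕ _kerRetract`, `isCommMonObj_fix`, and **`splitIso : G ≅ fix ε ⊗ Ker ε`**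
  (`x ↦ (ε x, x ε(x)⁻¹)`, inverse `(y, z) ↦ y z`) with `isMonHom_splitIso_hom` — an isomorphism of `S`-GROUP schemes;
* §4 functoriality **`fixMap`** along `φ : G ⟶ G'` with `φ ≫ ε' = ε ≫ φ` (`fixMap_ι`, `fixRetract_comp_fixMap`, closed immersion when
  `φ` is, homomorphism when `φ` is).

NOT HERE (left to the `stub_L42` provers): the assembly of the `Fix (e n)` of a Barsotti–Tate group into a `BTGroup` — its HEIGHT
(«the order of a finite flat commutative group scheme killed by `p` is a power of `p`», a separate lemma) and the FLATNESS of the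
restricted `[p]`-maps (not formal from the splitting; fibrewise ∕ fppf argument).

## References
* [GortzWedhorn2020] U. Görtz, T. Wedhorn, *Algebraic Geometry I*, 2nd ed. (2020) — (4.15) Definition 4.45 (p. 117).
* [AtiyahMacdonald1969] M. F. Atiyah, I. G. Macdonald, *Introduction to Commutative Algebra* (1969) — Ch. 2 Exercise 4 (p. 31).
* [Tate1967] J. T. Tate, *p-divisible groups* (1967) — §2; [RapoportSmithlingZhang2020Diagonal] §4.1.
-/

noncomputable section

universe u

open CategoryTheory CategoryTheory.Limits AlgebraicGeometry MonoidalCategory CartesianMonoidalCategory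
open scoped MonObj

namespace Literature.AlgebraicGeometry.GroupSchemes

namespace IdempotentSplitting

/-! ## §1 The fixed subgroup scheme `Fix ε = Ker (𝟙 ∕ ε)` of an endomorphism; the retraction `ε : G → Fix ε` -/

section Basic

variable {S : Scheme.{u}} {G : Over S} [GrpObj G] (ε : G ⟶ G)

/-- `t ≫ (𝟙 ∕ ε) = t ∕ (t ≫ ε)` for any `T`-valued point `t` (`𝟙 ∕ ε` is the pointwise quotient `x ↦ x · ε(x)⁻¹` in the
group `Hom(G, G)`, NOT a unit). [cite: GortzWedhorn2020, Definition 4.45 (2), p. 117] -/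
theorem comp_one_div {T : Over S} (t : T ⟶ G) : t ≫ ((𝟙 G) / ε) = t / (t ≫ ε) := by
  rw [div_eq_mul_inv, div_eq_mul_inv, MonObj.comp_mul, Category.comp_id, GrpObj.comp_inv]

/-- **The FIXED SUBSCHEME `Fix ε := Ker(𝟙 ∕ ε)`** of an endomorphism `ε` of an `S`-group scheme (`T`-points: the `t` with
`t ≫ ε = t`; a subGROUP scheme when `G` is commutative and `ε` a homomorphism, §3). [cite: GortzWedhorn2020, Definition 4.45 (2), p. 117] -/
def fix : Over S :=
  GroupSchemeKernel.ker ((𝟙 G) / ε)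

/-- The inclusion `ι : Fix ε ⟶ G`. [cite: GortzWedhorn2020, Definition 4.45 (2), p. 117] -/
def fixι : fix ε ⟶ G :=
  GroupSchemeKernel.kerι _

/-- `ι ≫ ε = ι`: the points of `Fix ε` are fixed. [cite: GortzWedhorn2020, Definition 4.45 (2), p. 117] -/
@[reassoc]
theorem fixι_comp : fixι ε ≫ ε = fixι ε := by
  have h : fixι ε ≫ ((𝟙 G) / ε) = 1 := GroupSchemeKernel.kerι_comp _
  rw [comp_one_div, div_eq_one] at h
  exact h.symm

/-- `ι : Fix ε ⟶ G` is a monomorphism. [cite: GortzWedhorn2020, Definition 4.45 (2), p. 117] -/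
theorem mono_fixι : Mono (fixι ε) :=
  GroupSchemeKernel.mono_kerι _

/-- Two morphisms into `Fix ε` agree iff they agree after `ι`. [cite: GortzWedhorn2020, Definition 4.45 (2), p. 117] -/
theorem fix_hom_ext {T : Over S} {a b : T ⟶ fix ε} (h : a ≫ fixι ε = b ≫ fixι ε) : a = b :=
  GroupSchemeKernel.ker_hom_ext h

/-- **The universal property of `Fix ε`**: an `ε`-fixed point (`t ≫ ε = t`) factors through `Fix ε`.
[cite: GortzWedhorn2020, Definition 4.45 (2), p. 117] -/
def fixLift {T : Over S} (t : T ⟶ G) (ht : t ≫ ε = t) : T ⟶ fix ε :=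
  GroupSchemeKernel.kerLift t (by rw [comp_one_div, ht, div_self'])

/-- `fixLift t _ ≫ ι = t`. [cite: GortzWedhorn2020, Definition 4.45 (2), p. 117] -/
@[reassoc (attr := simp)]
theorem fixLift_ι {T : Over S} (t : T ⟶ G) (ht : t ≫ ε = t) : fixLift ε t ht ≫ fixι ε = t :=
  GroupSchemeKernel.kerLift_ι _ _

/-- `ι : Fix ε ⟶ G` is a closed immersion on underlying schemes (`G → S` separated). [cite: GortzWedhorn2020, Definition 4.45 (2), p. 117] -/
theorem isClosedImmersion_fixι_left [IsSeparated G.hom] : IsClosedImmersion (fixι ε).left :=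
  GroupSchemeKernel.isClosedImmersion_kerι_left_of_isSeparated _

/-- **The retraction `G ⟶ Fix ε` defined by an IDEMPOTENT `ε` itself** (`ε ≫ ε = ε`). [cite: GortzWedhorn2020, Definition 4.45 (2), p. 117] -/
def fixRetract (hε : ε ≫ ε = ε) : G ⟶ fix ε :=
  fixLift ε ε hε

/-- `fixRetract ≫ ι = ε`. [cite: GortzWedhorn2020, Definition 4.45 (2), p. 117] -/
@[reassoc (attr := simp)]
theorem fixRetract_ι (hε : ε ≫ ε = ε) : fixRetract ε hε ≫ fixι ε = ε :=
  fixLift_ι ε ε hε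

/-- `ι ≫ fixRetract = 𝟙`: `Fix ε` is a RETRACT of `G` over `S`. [cite: GortzWedhorn2020, Definition 4.45 (2), p. 117] -/
@[reassoc (attr := simp)]
theorem fixι_fixRetract (hε : ε ≫ ε = ε) : fixι ε ≫ fixRetract ε hε = 𝟙 (fix ε) :=
  fix_hom_ext ε (by rw [Category.assoc, fixRetract_ι, fixι_comp, Category.id_comp])

/-- `Fix ε → S` is FINITE when `G → S` is (closed subscheme). [cite: GortzWedhorn2020, Definition 4.45 (2), p. 117] -/
theorem isFinite_fix_hom [IsFinite G.hom] : IsFinite (fix ε).hom := by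
  haveI : IsSeparated G.hom := inferInstance
  haveI := isClosedImmersion_fixι_left ε
  rw [← Over.w (fixι ε)]
  infer_instance

/-- **`Fix ε → S` is FLAT when `G → S` is and `ε` is idempotent** (`Fix ε` is a retract of `G` over `S`; ★
`Morphisms.flat_of_retract`; no commutativity, no homomorphism hypothesis). [cite: AtiyahMacdonald1969, Ch. 2 Exercise 4 (p. 31)] -/
theorem flat_fix_hom [Flat G.hom] (hε : ε ≫ ε = ε) : Flat (fix ε).hom :=
  Morphisms.flat_of_retract (fix ε).hom G.hom (fixι ε).left (fixRetract ε hε).left (Over.w _)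
    (by rw [← Over.comp_left, fixι_fixRetract]; rfl)

end Basic

/-! ## §2 The complementary retraction `𝟙 ∕ ε : G → Ker ε` (homomorphism `ε`) -/

section Hom

variable {S : Scheme.{u}} {G : Over S} [GrpObj G] (ε : G ⟶ G) [IsMonHom ε]

/-- For an idempotent homomorphism `ε`, `(𝟙 ∕ ε) ≫ ε = 1` (`ε⁻¹ ≫ ε = (ε ≫ ε)⁻¹` since `ε` is a homomorphism).
[cite: GortzWedhorn2020, Definition 4.45 (2), p. 117] -/
theorem one_div_comp_self (hε : ε ≫ ε = ε) : ((𝟙 G) / ε) ≫ ε = 1 := by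
  have h : ε⁻¹ ≫ ε = (ε ≫ ε)⁻¹ := by rw [← zpow_neg_one, GrpObj.zpow_comp, zpow_neg_one]
  rw [div_eq_mul_inv, MonObj.mul_comp, Category.id_comp, h, hε, mul_inv_cancel]

/-- **The retraction `G ⟶ Ker ε` defined by `𝟙 ∕ ε`** (idempotent homomorphism `ε`). [cite: GortzWedhorn2020, Definition 4.45 (2), p. 117] -/
def kerRetract (hε : ε ≫ ε = ε) : G ⟶ GroupSchemeKernel.ker ε :=
  GroupSchemeKernel.kerLift ((𝟙 G) / ε) (one_div_comp_self ε hε)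

/-- `kerRetract ≫ ι = 𝟙 ∕ ε`. [cite: GortzWedhorn2020, Definition 4.45 (2), p. 117] -/
@[reassoc (attr := simp)]
theorem kerRetract_ι (hε : ε ≫ ε = ε) : kerRetract ε hε ≫ GroupSchemeKernel.kerι ε = (𝟙 G) / ε :=
  GroupSchemeKernel.kerLift_ι _ _

/-- `ι ≫ kerRetract = 𝟙`: `Ker ε` is a RETRACT of `G` over `S`. [cite: GortzWedhorn2020, Definition 4.45 (2), p. 117] -/
@[reassoc (attr := simp)]
theorem kerι_kerRetract (hε : ε ≫ ε = ε) : GroupSchemeKernel.kerι ε ≫ kerRetract ε hε = 𝟙 _ :=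
  GroupSchemeKernel.ker_hom_ext (by
    rw [Category.assoc, kerRetract_ι, comp_one_div, GroupSchemeKernel.kerι_comp, div_one, Category.id_comp])

omit [IsMonHom ε] in
/-- `Ker ε → S` is FINITE when `G → S` is. [cite: GortzWedhorn2020, Definition 4.45 (2), p. 117] -/
theorem isFinite_ker_hom [IsFinite G.hom] : IsFinite (GroupSchemeKernel.ker ε).hom := by
  haveI : IsSeparated G.hom := inferInstance
  haveI := GroupSchemeKernel.isClosedImmersion_kerι_left_of_isSeparated ε
  rw [← Over.w (GroupSchemeKernel.kerι ε)]
  infer_instance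

/-- **`Ker ε → S` is FLAT when `G → S` is and `ε` is an idempotent homomorphism** (`Ker ε` is a retract of `G` over `S`).
[cite: AtiyahMacdonald1969, Ch. 2 Exercise 4 (p. 31)] -/
theorem flat_ker_hom [Flat G.hom] (hε : ε ≫ ε = ε) : Flat (GroupSchemeKernel.ker ε).hom :=
  Morphisms.flat_of_retract (GroupSchemeKernel.ker ε).hom G.hom (GroupSchemeKernel.kerι ε).left (kerRetract ε hε).left
    (Over.w _) (by rw [← Over.comp_left, kerι_kerRetract]; rfl)

end Hom

/-! ## §3 Commutative `G`: `Fix ε` is a subgroup scheme and `G ≅ Fix ε × Ker ε` as group schemes -/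

section Comm

variable {S : Scheme.{u}} {G : Over S} [GrpObj G] [IsCommMonObj G] (ε : G ⟶ G) [IsMonHom ε]

/-- `𝟙 ∕ ε` is a homomorphism (commutative `G`). [cite: GortzWedhorn2020, Definition 4.45 (2), p. 117] -/
theorem isMonHom_one_div : IsMonHom ((𝟙 G) / ε) := by
  rw [div_eq_mul_inv, Hom.mul_def]
  infer_instance

/-- The group structure of `Fix ε` (kernel of the homomorphism `𝟙 ∕ ε`; a reducible `def`, not an instance: bind with `letI`).
[cite: GortzWedhorn2020, Definition 4.45 (2), p. 117] -/
@[reducible] def fixGrpObj : GrpObj (fix ε) :=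
  haveI := isMonHom_one_div ε
  GroupSchemeKernel.grpObjKer ((𝟙 G) / ε)

/-- `ι : Fix ε ⟶ G` is a homomorphism. [cite: GortzWedhorn2020, Definition 4.45 (2), p. 117] -/
theorem isMonHom_fixι : letI := fixGrpObj ε; IsMonHom (fixι ε) := by
  haveI := isMonHom_one_div ε
  exact GroupSchemeKernel.isMonHom_kerι _

/-- A homomorphism into `G` through fixed points lifts to a HOMOMORPHISM into `Fix ε`. [cite: GortzWedhorn2020, Definition 4.45 (2), p. 117] -/
theorem isMonHom_fixLift {T : Over S} [MonObj T] (t : T ⟶ G) [IsMonHom t] (ht : t ≫ ε = t) :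
    letI := fixGrpObj ε; IsMonHom (fixLift ε t ht) := by
  haveI := isMonHom_one_div ε
  unfold fixLift
  exact GroupSchemeKernel.isMonHom_kerLift _ _

/-- `Fix ε` is commutative. [cite: GortzWedhorn2020, Definition 4.45 (2), p. 117] -/
theorem isCommMonObj_fix : letI := fixGrpObj ε; IsCommMonObj (fix ε) := by
  letI := fixGrpObj ε
  haveI := isMonHom_fixι ε
  haveI := mono_fixι ε
  rw [isCommMonObj_iff_isMulCommutative]
  intro X
  refine ⟨⟨fun a b => ?_⟩⟩
  rw [← cancel_mono (fixι ε), MonObj.mul_comp, MonObj.mul_comp, mul_comm]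

/-- `fixRetract` is a homomorphism. [cite: GortzWedhorn2020, Definition 4.45 (2), p. 117] -/
theorem isMonHom_fixRetract (hε : ε ≫ ε = ε) : letI := fixGrpObj ε; IsMonHom (fixRetract ε hε) :=
  isMonHom_fixLift ε ε hε

/-- `kerRetract` is a homomorphism. [cite: GortzWedhorn2020, Definition 4.45 (2), p. 117] -/
theorem isMonHom_kerRetract (hε : ε ≫ ε = ε) : IsMonHom (kerRetract ε hε) := by
  haveI := isMonHom_one_div ε
  unfold kerRetract
  exact GroupSchemeKernel.isMonHom_kerLift _ _

/-- **THE SPLITTING `G ≅ Fix ε ⊗ Ker ε` defined by an idempotent endomorphism** `ε` of a commutative `S`-group scheme: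
`x ↦ (ε x, x · ε(x)⁻¹)` with inverse `(y, z) ↦ y · z`. [cite: GortzWedhorn2020, Definition 4.45 (2), p. 117] -/
def splitIso (hε : ε ≫ ε = ε) : G ≅ fix ε ⊗ GroupSchemeKernel.ker ε where
  hom := lift (fixRetract ε hε) (kerRetract ε hε)
  inv := (fst _ _ ≫ fixι ε) * (snd _ _ ≫ GroupSchemeKernel.kerι ε)
  hom_inv_id := by
    rw [MonObj.comp_mul, lift_fst_assoc, lift_snd_assoc, fixRetract_ι, kerRetract_ι, mul_div_cancel]
  inv_hom_id := by
    haveI := mono_fixι ε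
    haveI := GroupSchemeKernel.mono_kerι ε
    apply CartesianMonoidalCategory.hom_ext
    · rw [Category.assoc, lift_fst, Category.id_comp, ← cancel_mono (fixι ε), Category.assoc, fixRetract_ι,
        MonObj.mul_comp, Category.assoc, fixι_comp, Category.assoc, GroupSchemeKernel.kerι_comp, MonObj.comp_one,
        mul_one]
    · rw [Category.assoc, lift_snd, Category.id_comp, ← cancel_mono (GroupSchemeKernel.kerι ε), Category.assoc,
        kerRetract_ι, comp_one_div, MonObj.mul_comp, Category.assoc, fixι_comp, Category.assoc,
        GroupSchemeKernel.kerι_comp, MonObj.comp_one, mul_one, mul_div_cancel_left]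

/-- Unfolding the splitting. [cite: GortzWedhorn2020, Definition 4.45 (2), p. 117] -/
theorem splitIso_hom (hε : ε ≫ ε = ε) : (splitIso ε hε).hom = lift (fixRetract ε hε) (kerRetract ε hε) := rfl

/-- Unfolding the inverse of the splitting. [cite: GortzWedhorn2020, Definition 4.45 (2), p. 117] -/
theorem splitIso_inv (hε : ε ≫ ε = ε) :
    (splitIso ε hε).inv = (fst _ _ ≫ fixι ε) * (snd _ _ ≫ GroupSchemeKernel.kerι ε) := rfl

/-- The splitting is an isomorphism of `S`-GROUP schemes. [cite: GortzWedhorn2020, Definition 4.45 (2), p. 117] -/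
theorem isMonHom_splitIso_hom (hε : ε ≫ ε = ε) : letI := fixGrpObj ε; IsMonHom (splitIso ε hε).hom := by
  letI := fixGrpObj ε
  haveI := isMonHom_fixRetract ε hε
  haveI := isMonHom_kerRetract ε hε
  rw [splitIso_hom]
  infer_instance

end Comm

/-! ## §4 Functoriality of `Fix` -/

section Map

variable {S : Scheme.{u}} {G G' : Over S} [GrpObj G] [GrpObj G'] (ε : G ⟶ G) (ε' : G' ⟶ G') (φ : G ⟶ G')

/-- **`Fix` is functorial** in morphisms commuting with the endomorphisms: `φ ≫ ε' = ε ≫ φ` induces `Fix ε ⟶ Fix ε'`.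
[cite: GortzWedhorn2020, Definition 4.45 (2), p. 117] -/
def fixMap (hφ : φ ≫ ε' = ε ≫ φ) : fix ε ⟶ fix ε' :=
  fixLift ε' (fixι ε ≫ φ) (by rw [Category.assoc, hφ, fixι_comp_assoc])

/-- `fixMap ≫ ι' = ι ≫ φ`. [cite: GortzWedhorn2020, Definition 4.45 (2), p. 117] -/
@[reassoc (attr := simp)]
theorem fixMap_ι (hφ : φ ≫ ε' = ε ≫ φ) : fixMap ε ε' φ hφ ≫ fixι ε' = fixι ε ≫ φ :=
  fixLift_ι _ _ _

/-- `fixMap` commutes with the retractions: `fixRetract ≫ fixMap = φ ≫ fixRetract'`. [cite: GortzWedhorn2020, Definition 4.45 (2), p. 117] -/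
@[reassoc]
theorem fixRetract_comp_fixMap (hε : ε ≫ ε = ε) (hε' : ε' ≫ ε' = ε') (hφ : φ ≫ ε' = ε ≫ φ) :
    fixRetract ε hε ≫ fixMap ε ε' φ hφ = φ ≫ fixRetract ε' hε' :=
  fix_hom_ext ε' (by rw [Category.assoc, fixMap_ι, fixRetract_ι_assoc, Category.assoc, fixRetract_ι, hφ])

/-- On underlying schemes `fixMap` is a closed immersion when `φ` is (e.g. along the transitions of a Barsotti–Tate group).
[cite: GortzWedhorn2020, Definition 4.45 (2), p. 117] -/
theorem isClosedImmersion_fixMap_left [IsSeparated G'.hom] [IsClosedImmersion φ.left] (hφ : φ ≫ ε' = ε ≫ φ) :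
    IsClosedImmersion (fixMap ε ε' φ hφ).left := by
  haveI := isClosedImmersion_fixι_left ε'
  haveI : IsSeparated G.hom := by
    rw [← Over.w φ]
    infer_instance
  haveI := isClosedImmersion_fixι_left ε
  haveI : IsClosedImmersion ((fixMap ε ε' φ hφ).left ≫ (fixι ε').left) := by
    rw [← Over.comp_left, fixMap_ι, Over.comp_left]
    infer_instance
  exact IsClosedImmersion.of_comp_isClosedImmersion _ (fixι ε').left

/-- `fixMap` of a homomorphism is a homomorphism (commutative `G`, `G'`, homomorphisms `ε`, `ε'`).
[cite: GortzWedhorn2020, Definition 4.45 (2), p. 117] -/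
theorem isMonHom_fixMap [IsCommMonObj G] [IsCommMonObj G'] [IsMonHom ε] [IsMonHom ε'] [IsMonHom φ]
    (hφ : φ ≫ ε' = ε ≫ φ) : letI := fixGrpObj ε; letI := fixGrpObj ε'; IsMonHom (fixMap ε ε' φ hφ) := by
  letI := fixGrpObj ε
  haveI := isMonHom_fixι ε
  exact isMonHom_fixLift ε' _ _

end Map

end IdempotentSplitting

end Literature.AlgebraicGeometry.GroupSchemes

end
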